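import Mathlib
import Summits.ValiantsHypothesis.ValiantsHypothesis.Theorems.ProofCarryingSymmetryRestorationQPACComb

/-!
# Route ProofCarryingSymmetry — crux `RestorationQP`, line `registered`: automorphisms act on binarised formulas modulo AC

B-core″, part 2.  For a Dawar–Wilsenach labelled circuit `D` and a circuit automorphism `π`
extending the action of `γ` on the variables (`IsAutomorphismExtending`, DW Def. 3.6), the
binarised formula (`ACStability.binTree`, part 1) of the image gate is the renamed binarised formula
of the gate, MODULO ASSOCIATIVITY AND COMMUTATIVITY:

  `binTree D (π g) ≈_AC (binTree D g).rename (γ • ·)`   (`acEq_binTree_perm`),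

because `children (π g) = π '' children g` enumerates (by `Finset.toList`) to a permutation of the
image of the enumeration of `children g`, and combs of permuted / pointwise AC-equivalent lists are
AC-equivalent (part 1).  Consequently a `Γ`-SYMMETRIC circuit (DW Def. 3.7) has, for every `γ`, the
binarised formula of its (fixed) output invariant under renaming by `γ` up to AC
(`acEq_rename_binTree_output`) — the converse direction of the stability rung S3″ at the level of
formulas.  Registered helper: `proofsToACEquiv_aux_binTreeSymm`.  Everything proved; no named facts.
-/

-- single-problem summit: `Summit.ValiantsHypothesis.ValiantsHypothesis.…` is the namespace by design (D-0017)
set_option linter.dupNamespace false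

noncomputable section

open scoped Classical

namespace Summit.ValiantsHypothesis.ValiantsHypothesis.Theorems

namespace ACStability

open Literature.Computability.AlgebraicComplexity

universe u v

variable {𝔽 : Type u} [Zero 𝔽] [One 𝔽] {X : Type v} {Yo : Type*} {G : Type*}
variable {Γ : Type*} [Group Γ] [MulAction Γ X] [MulAction Γ Yo]

omit [Zero 𝔽] [One 𝔽] in
/-- Under an automorphism, the children of the image gate enumerate to a permutation of the image
of the enumeration of the children. [folklore] -/
theorem perm_toList_children {D : LabelledArithCircuit 𝔽 X Yo G} {γ : Γ} {π : Equiv.Perm G}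
    (h : D.IsAutomorphismExtending γ π) (g : G) :
    ((D.children g).toList.map π).Perm (D.children (π g)).toList := by
  apply List.perm_of_nodup_nodup_toFinset_eq
  · exact (Finset.nodup_toList _).map π.injective
  · exact Finset.nodup_toList _
  · ext x
    simp only [List.mem_toFinset, List.mem_map, Finset.mem_toList, h.children_apply, Finset.mem_map,
      Equiv.toEmbedding_apply]

/-- **Automorphisms act on binarised formulas modulo AC**: if `π` is a circuit automorphism
extending `γ`, then `(binTree D g) ∘ γ ≈_AC binTree D (π g)` for every gate `g`. [folklore] -/
theorem acEq_binTree_perm {D : LabelledArithCircuit 𝔽 X Yo G} {γ : Γ} {π : Equiv.Perm G}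
    (h : D.IsAutomorphismExtending γ π) :
    ∀ g, ACEq ((binTree D g).rename fun x => γ • x) (binTree D (π g)) := by
  intro g
  induction g using D.wf.induction with
  | h g ih =>
    have hlab : D.label (π g) = γ • D.label g := h.label_apply g
    rcases hl : D.label g with x | c | _ | _
    · rw [hl, CircuitLabel.smul_var] at hlab
      rw [binTree_of_var D hl, binTree_of_var D hlab]
      exact .refl _
    · rw [hl, CircuitLabel.smul_const] at hlab
      rw [binTree_of_const D hl, binTree_of_const D hlab]
      exact .refl _
    · rw [hl, CircuitLabel.smul_add] at hlab
      rw [binTree_of_add D hl, binTree_of_add D hlab, combGate_add_rename, List.map_map]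
      -- pointwise by induction, then permute the enumeration
      have h1 : List.Forall₂ ACEq ((D.children g).toList.map (PIFormula.rename (fun x => γ • x) ∘ binTree D))
          ((D.children g).toList.map (binTree D ∘ π)) := by
        rw [List.forall₂_map_left_iff, List.forall₂_map_right_iff, List.forall₂_same]
        intro k hk
        exact ih k (Finset.mem_toList.1 hk)
      have h2 : ((D.children g).toList.map (binTree D ∘ π)).Perm ((D.children (π g)).toList.map (binTree D)) := by
        rw [← List.map_map]
        exact (perm_toList_children h g).map _
      exact (acEq_combGate_add_of_forall₂ h1).trans (acEq_combGate_add_of_perm h2)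
    · rw [hl, CircuitLabel.smul_mul] at hlab
      rw [binTree_of_mul D hl, binTree_of_mul D hlab, combGate_mul_rename, List.map_map]
      have h1 : List.Forall₂ ACEq ((D.children g).toList.map (PIFormula.rename (fun x => γ • x) ∘ binTree D))
          ((D.children g).toList.map (binTree D ∘ π)) := by
        rw [List.forall₂_map_left_iff, List.forall₂_map_right_iff, List.forall₂_same]
        intro k hk
        exact ih k (Finset.mem_toList.1 hk)
      have h2 : ((D.children g).toList.map (binTree D ∘ π)).Perm ((D.children (π g)).toList.map (binTree D)) := by
        rw [← List.map_map]
        exact (perm_toList_children h g).map _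
      exact (acEq_combGate_mul_of_forall₂ h1).trans (acEq_combGate_mul_of_perm h2)

/-- **The binarised output formula of a symmetric circuit is AC-invariant.** For a `Γ`-symmetric
circuit with outputs indexed by a `Γ`-set and an output index `y` fixed by `γ`, renaming the
binarised formula of the output gate by `γ` gives an AC-equivalent formula. [folklore] -/
theorem acEq_rename_binTree_output {D : LabelledArithCircuit 𝔽 X Yo G} (hD : D.IsSymmetric Γ)
    (γ : Γ) {y : Yo} (hy : γ • y = y) :
    ACEq ((binTree D (D.output y)).rename fun x => γ • x) (binTree D (D.output y)) := by
  obtain ⟨π, hπ⟩ := hD γ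
  have := acEq_binTree_perm hπ (D.output y)
  rwa [← hπ.output_smul y, hy] at this

end ACStability

open Literature.Computability.AlgebraicComplexity in
/-- **Symmetric circuits binarise to AC-invariant formulas** (registered helper toward the converse
of S3″ / honesty of stub S2″ `stub_proofsToACEquiv`, crux `RestorationQP`): for an `S_n`-symmetric
single-output labelled circuit over `ℂ` in the matrix variables, the binarised formula of the output
is invariant, modulo associativity and commutativity, under every relabelling `x_ij ↦ x_{σ i, σ j}`.
[folklore] -/
theorem proofsToACEquiv_aux_binTreeSymm : ∀ (n : ℕ) (G : Type) (D : LabelledArithCircuit ℂ (Fin n × Fin n) Unit G), D.IsSymmetric (Equiv.Perm (Fin n)) → ∀ σ : Equiv.Perm (Fin n), ACStability.ACEq ((ACStability.binTree D (D.output ())).rename fun x : Fin n × Fin n => σ • x) (ACStability.binTree D (D.output ())) := by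
  intro n G D hD σ
  exact ACStability.acEq_rename_binTree_output hD σ rfl

end Summit.ValiantsHypothesis.ValiantsHypothesis.Theorems

end
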